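import Literature.Probability.RandomPlanarGeometry.StarHullOneStepKappa
import Literature.Probability.RandomPlanarGeometry.StarHullOneStepMass
import HarnessLib

/-!
# The compensated one-step expansion of `Y = Φ'_B(0)^α · exp(−λ ∫ m)` ([LSW] Prop. 5.3, deterministic part)

Sequel to `StarHullOneStepKappa` (expansion of `d′^α − d^α`, `d = Φ′_B(0)`) and
`StarHullOneStepMass` (the Schwarzian mass `m(B) = −SE_B(0)/6` moves by `O(u + η)` over a step),
after

* G. F. Lawler, O. Schramm, W. Werner, *Conformal restriction: the chordal case*, J. Amer. Math.
  Soc. **16** (2003) 917–955, arXiv:math/0209343 (**[LSW]**), §5 (5.2)–(5.3) and Prop. 5.3: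
  for `α = α_κ`, `λ = λ_κ`, "`Y_t = h_t′(W_t)^α exp(λ ∫₀ᵗ Sh_s(W_s)/6 ds)`, `t < T`, is a local
  martingale. If `κ ≤ 8/3`, then `Y_t` is a bounded martingale".

Over one step of length `u` of the flow the compensator changes by the factor `exp(−λ J)`,
`J = ∫ₜ^{t+u} m(A_s − W_s) ds` (`m = −Sh/6 ≥ 0`), and `J = u · m(A_t − W_t) + O(u (u + η))`
(`StarHullOneStepMass`). We PROVE:

* `Literature.Probability.RandomPlanarGeometry.abs_compensated_sub_le` — the **abstract
  compensated expansion**: if `|Y′ − Y − P| ≤ E₁`, `0 ≤ Y ≤ 1`, `|P| ≤ K_P (a + u)`, `0 ≤ J ≤ u M`,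
  `λ u M ≤ 1`, `|J − u m| ≤ E_J`, then
  `|Y′ e^{−λJ} − Y − (P − λ u m Y)| ≤ E₁ + K_P (a + u) λ u M + (λ u M)² + λ E_J`
  (`|e^{−y} − 1| ≤ y`, `|e^{−y} − 1 + y| ≤ y²` for `0 ≤ y ≤ 1`);
* `Literature.Probability.RandomPlanarGeometry.Loewner.abs_stepModelK_le` — `|stepModelK| ≤
  modelKP α δ₀ ρ₀ · (|x| + u)` on the controlled class (`|x| ≤ 1`), and
  `Loewner.abs_stepModelK_le_all` — `|stepModelK| ≤ modelKA1 · |x| + modelKA2 · (x² + (8/3)u)` for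
  every `x` (for the bad event, where the increment is large);
* **`Literature.Probability.RandomPlanarGeometry.Loewner.abs_compensatedStep_le`** — for a
  `*`-hull `B` of the controlled class (`δ₀ ≤ Φ′_B(0)`, off `B(0, 8ρ₀)`, `ρ₀ ≤ 1`), one step
  (`u ≤ 1`, `η = stepSize S u ≤ 1`, `x = U_u`), `α > 0`, `λ ≥ 0` with `λ u M_m ≤ 1`
  (`M_m = massBound δ₀ ρ₀ ≥ |m|`), and every `J` with `0 ≤ J ≤ u M_m`,
  `|J − u m(B)| ≤ u · massStepC δ₀ ρ₀ (u + η)`: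
  `|d′^α e^{−λJ} − d^α − (stepModelK α d c₂ c₃ u x − λ u m(B) d^α)| ≤ compK α λ δ₀ ρ₀ · (u η + u² + |x|³ + u |x|)`.
  The mean of the model `stepModelK − λ u m d^α` over a Brownian increment (`E x = 0`,
  `E x² = κ u`) is `u (driftCoeffK κ α d c₂ c₃ − λ m d^α)`, which VANISHES for `α = α_κ`,
  `λ = λ_κ` (`driftCoeffK_sleBubbleExponent'` of `SLEBubblesSchwarzianMass`, with
  `m = bubbleMass d (c₂/2) (c₃/6)`): this is [LSW] Prop. 5.3 in conditional-increment form.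

## References

* [LSW] §5 (5.2)–(5.3), Prop. 5.3. [LawlerSchrammWerner2003Restriction]
* Lawler (2005), §4.6.1 (4.35)–(4.37). [Lawler2005]
-/

noncomputable section

open Set Filter Metric Function
open _root_.Complex _root_.Topology _root_.Real
open UpperHalfPlane (upperHalfPlaneSet)
open scoped NNReal

namespace Literature.Probability.RandomPlanarGeometry

/-! ### Two exponential inequalities and the abstract compensated expansion -/

/-- `|e^{−y} − 1| ≤ y` for `y ≥ 0`. [folklore] -/
theorem abs_exp_neg_sub_one_le {y : ℝ} (hy : 0 ≤ y) : |Real.exp (-y) - 1| ≤ y := by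
  have h1 : Real.exp (-y) ≤ 1 := Real.exp_le_one_iff.2 (by linarith)
  have h2 : 1 - y ≤ Real.exp (-y) := by
    have := Real.add_one_le_exp (-y); linarith
  rw [abs_le]; constructor <;> linarith

/-- `|e^{−y} − 1 + y| ≤ y²` for `0 ≤ y ≤ 1` (`Real.abs_exp_sub_one_sub_id_le`). [folklore] -/
theorem abs_exp_neg_sub_one_add_le {y : ℝ} (hy : 0 ≤ y) (hy1 : y ≤ 1) :
    |Real.exp (-y) - 1 + y| ≤ y ^ 2 := by
  have := Real.abs_exp_sub_one_sub_id_le (x := -y) (by rw [abs_neg, abs_of_nonneg hy]; exact hy1)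
  rw [sub_neg_eq_add, neg_sq] at this
  exact this

/-- **The abstract compensated expansion**: with `e = exp(−λ J)`,
`Y′ e − Y − (P − λ u m Y) = (Y′ − Y − P) e + P (e − 1) + Y (e − 1 + λ J) + λ Y (u m − J)`, and the
four terms are bounded by `E₁`, `K_P (a + u) · λ u M`, `(λ u M)²`, `λ E_J`. [folklore] -/
theorem abs_compensated_sub_le {Y Y' P J m lam u E₁ KP a M EJ : ℝ}
    (hY0 : 0 ≤ Y) (hY1 : Y ≤ 1) (hlam : 0 ≤ lam) (hJ0 : 0 ≤ J)
    (hE : |Y' - Y - P| ≤ E₁) (hP : |P| ≤ KP * (a + u)) (hJM : J ≤ u * M)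
    (hlam1 : lam * (u * M) ≤ 1) (hJ : |J - u * m| ≤ EJ) :
    |Y' * Real.exp (-(lam * J)) - Y - (P - lam * u * m * Y)| ≤
      E₁ + KP * (a + u) * (lam * (u * M)) + (lam * (u * M)) ^ 2 + lam * EJ := by
  set e := Real.exp (-(lam * J)) with he
  have hy0 : 0 ≤ lam * J := mul_nonneg hlam hJ0
  have hy1 : lam * J ≤ lam * (u * M) := mul_le_mul_of_nonneg_left hJM hlam
  have he1 : e ≤ 1 := Real.exp_le_one_iff.2 (by linarith)
  have he0 : 0 < e := Real.exp_pos _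
  have hKP : 0 ≤ KP * (a + u) := (abs_nonneg _).trans hP
  -- decomposition
  have hdec : Y' * e - Y - (P - lam * u * m * Y) =
      (Y' - Y - P) * e + P * (e - 1) + Y * (e - 1 + lam * J) + lam * Y * (u * m - J) := by ring
  rw [hdec]
  -- the four bounds
  have b1 : |(Y' - Y - P) * e| ≤ E₁ := by
    rw [abs_mul, abs_of_pos he0]
    calc |Y' - Y - P| * e ≤ E₁ * 1 := mul_le_mul hE he1 he0.le ((abs_nonneg _).trans hE)
      _ = E₁ := mul_one _
  have b2 : |P * (e - 1)| ≤ KP * (a + u) * (lam * (u * M)) := by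
    rw [abs_mul]
    exact mul_le_mul hP ((abs_exp_neg_sub_one_le hy0).trans hy1) (abs_nonneg _) hKP
  have b3 : |Y * (e - 1 + lam * J)| ≤ (lam * (u * M)) ^ 2 := by
    rw [abs_mul, abs_of_nonneg hY0]
    have h1 : |e - 1 + lam * J| ≤ (lam * J) ^ 2 := abs_exp_neg_sub_one_add_le hy0 (hy1.trans hlam1)
    have h2 : (lam * J) ^ 2 ≤ (lam * (u * M)) ^ 2 := pow_le_pow_left₀ hy0 hy1 2
    calc Y * |e - 1 + lam * J| ≤ 1 * (lam * (u * M)) ^ 2 := mul_le_mul hY1 (h1.trans h2) (abs_nonneg _) zero_le_one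
      _ = _ := one_mul _
  have b4 : |lam * Y * (u * m - J)| ≤ lam * EJ := by
    rw [abs_mul, abs_mul, abs_of_nonneg hlam, abs_of_nonneg hY0, abs_sub_comm]
    calc lam * Y * |J - u * m| ≤ lam * 1 * EJ :=
          mul_le_mul (mul_le_mul_of_nonneg_left hY1 hlam) hJ (abs_nonneg _) (by positivity)
      _ = lam * EJ := by ring
  have := abs_add_three ((Y' - Y - P) * e + P * (e - 1)) (Y * (e - 1 + lam * J)) (lam * Y * (u * m - J))
  have := abs_add_le ((Y' - Y - P) * e) (P * (e - 1))
  linarith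

namespace Loewner

/-! ### The size of the model `stepModelK` -/

/-- The constant of `abs_stepModelK_le`. [folklore] -/
def modelKP (α δ₀ ρ₀ : ℝ) : ℝ :=
  ratioK α δ₀ * (5 / 8 * δ₀ ^ (-(3 / 8 : ℝ)) * (1 / ρ₀ + 1 / ρ₀ ^ 2 + 1 / (2 * δ₀ * ρ₀ ^ 2) + 3 / ρ₀ ^ 2) +
    15 / 128 * δ₀ ^ (-(11 / 8 : ℝ)) * (1 / ρ₀ ^ 2))

/-- `0 ≤ modelKP`. [folklore] -/
theorem modelKP_nonneg {α δ₀ ρ₀ : ℝ} (hα : 0 ≤ α) (hδ0 : 0 < δ₀) (hρ₀ : 0 < ρ₀) : 0 ≤ modelKP α δ₀ ρ₀ := by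
  unfold modelKP
  have := ratioK_nonneg hα hδ0
  have h1 : 0 ≤ δ₀ ^ (-(3 / 8 : ℝ)) := Real.rpow_nonneg hδ0.le _
  have h2 : 0 ≤ δ₀ ^ (-(11 / 8 : ℝ)) := Real.rpow_nonneg hδ0.le _
  positivity

/-- **`|stepModelK α d c₂ c₃ u x| ≤ modelKP α δ₀ ρ₀ · (|x| + u)`** for `0 < α`, `δ₀ ≤ d ≤ 1`,
`|c₂| ≤ 1/ρ₀`, `|c₃| ≤ 2/ρ₀²`, `|x| ≤ 1` (the prefactors compared with the case `α = 5/8` by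
`ratioK_spec`). [folklore] -/
theorem abs_stepModelK_le {α d c₂ c₃ x δ₀ ρ₀ : ℝ} {u : ℝ≥0} (hα : 0 < α) (hδ0 : 0 < δ₀) (hρ₀ : 0 < ρ₀)
    (hδ : δ₀ ≤ d) (hd1 : d ≤ 1) (hc2 : |c₂| ≤ 1 / ρ₀) (hc3 : |c₃| ≤ 2 / ρ₀ ^ 2) (hx1 : |x| ≤ 1) :
    |stepModelK α d c₂ c₃ u x| ≤ modelKP α δ₀ ρ₀ * (|x| + u) := by
  have hd0 : 0 < d := hδ0.trans_le hδ
  have hu0 : (0 : ℝ) ≤ u := u.coe_nonneg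
  have ha0 : 0 ≤ |x| := abs_nonneg _
  obtain ⟨-, r2, r3⟩ := ratioK_spec hα hδ0 hδ hd1
  have hL0 : 0 ≤ ratioK α δ₀ := ratioK_nonneg hα.le hδ0
  -- the bracket `L = c₂ x + c₃ x²/2 + u (c₂²/(2d) − (4/3) c₃)`
  have hLb : |c₂ * x + c₃ * x ^ 2 / 2 + u * (c₂ ^ 2 / (2 * d) - 4 / 3 * c₃)| ≤
      (1 / ρ₀ + 1 / ρ₀ ^ 2) * |x| + (1 / (2 * δ₀ * ρ₀ ^ 2) + 3 / ρ₀ ^ 2) * u := by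
    have e1 : |c₂ * x| ≤ 1 / ρ₀ * |x| := by rw [abs_mul]; exact mul_le_mul_of_nonneg_right hc2 ha0
    have e2 : |c₃ * x ^ 2 / 2| ≤ 1 / ρ₀ ^ 2 * |x| := by
      rw [abs_div, abs_mul, abs_pow, abs_two]
      have hx2 : |x| ^ 2 ≤ |x| := by nlinarith
      have := mul_le_mul hc3 hx2 (by positivity) (by positivity)
      have h' : 2 / ρ₀ ^ 2 * |x| / 2 = 1 / ρ₀ ^ 2 * |x| := by ring
      rw [← h']
      exact div_le_div_of_nonneg_right this (by norm_num)
    have e3 : |(u : ℝ) * (c₂ ^ 2 / (2 * d) - 4 / 3 * c₃)| ≤ (1 / (2 * δ₀ * ρ₀ ^ 2) + 3 / ρ₀ ^ 2) * u := by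
      rw [abs_mul, abs_of_nonneg hu0, mul_comm]
      refine mul_le_mul_of_nonneg_right ((abs_sub _ _).trans (add_le_add ?_ ?_)) hu0
      · rw [abs_div, abs_of_nonneg (sq_nonneg _), abs_of_pos (by positivity : (0 : ℝ) < 2 * d),
          div_le_div_iff₀ (by positivity) (by positivity)]
        have g1 : c₂ ^ 2 ≤ (1 / ρ₀) ^ 2 := by rw [← sq_abs]; exact pow_le_pow_left₀ (abs_nonneg _) hc2 2
        have g2 : c₂ ^ 2 * ρ₀ ^ 2 ≤ 1 := by
          have := mul_le_mul_of_nonneg_right g1 (sq_nonneg ρ₀)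
          rwa [show (1 / ρ₀) ^ 2 * ρ₀ ^ 2 = 1 by field_simp] at this
        calc c₂ ^ 2 * (2 * δ₀ * ρ₀ ^ 2) = (c₂ ^ 2 * ρ₀ ^ 2) * (2 * δ₀) := by ring
          _ ≤ 1 * (2 * δ₀) := mul_le_mul_of_nonneg_right g2 (by positivity)
          _ ≤ 1 * (2 * d) := by nlinarith
      · rw [abs_mul, show |(4 : ℝ) / 3| = 4 / 3 by norm_num]
        have g1 := mul_le_mul_of_nonneg_left hc3 (by norm_num : (0 : ℝ) ≤ 4 / 3)
        have g2 : 4 / 3 * (2 / ρ₀ ^ 2) ≤ 3 / ρ₀ ^ 2 := by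
          rw [← mul_div_assoc, div_le_div_iff_of_pos_right (by positivity)]; norm_num
        exact g1.trans g2
    have e4 := abs_add_three (c₂ * x) (c₃ * x ^ 2 / 2) ((u : ℝ) * (c₂ ^ 2 / (2 * d) - 4 / 3 * c₃))
    have e5 : 1 / ρ₀ * |x| + 1 / ρ₀ ^ 2 * |x| = (1 / ρ₀ + 1 / ρ₀ ^ 2) * |x| := by ring
    linarith
  have hL0' : 0 ≤ (1 / ρ₀ + 1 / ρ₀ ^ 2) * |x| + (1 / (2 * δ₀ * ρ₀ ^ 2) + 3 / ρ₀ ^ 2) * u := by positivity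
  -- the quadratic term
  have hQb : |c₂ ^ 2 * x ^ 2| ≤ 1 / ρ₀ ^ 2 * |x| := by
    rw [abs_mul, abs_of_nonneg (sq_nonneg c₂), abs_pow, sq_abs]
    have g1 : c₂ ^ 2 ≤ (1 / ρ₀) ^ 2 := by rw [← sq_abs]; exact pow_le_pow_left₀ (abs_nonneg _) hc2 2
    have hx2 : x ^ 2 ≤ |x| := by have := sq_abs x; nlinarith [abs_nonneg x]
    calc c₂ ^ 2 * x ^ 2 ≤ (1 / ρ₀) ^ 2 * |x| := mul_le_mul g1 hx2 (sq_nonneg _) (by positivity)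
      _ = 1 / ρ₀ ^ 2 * |x| := by ring
  -- prefactor bounds at `d ≥ δ₀`
  have hT2 : d ^ (-(3 / 8 : ℝ)) ≤ δ₀ ^ (-(3 / 8 : ℝ)) := Real.rpow_le_rpow_of_nonpos hδ0 hδ (by norm_num)
  have hT3 : d ^ (-(11 / 8 : ℝ)) ≤ δ₀ ^ (-(11 / 8 : ℝ)) := Real.rpow_le_rpow_of_nonpos hδ0 hδ (by norm_num)
  have hp1 : α * d ^ (α - 1) ≤ ratioK α δ₀ * (5 / 8 * δ₀ ^ (-(3 / 8 : ℝ))) :=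
    r2.trans (mul_le_mul_of_nonneg_left (mul_le_mul_of_nonneg_left hT2 (by norm_num)) hL0)
  have hp2 : |α * (α - 1)| * d ^ (α - 2) / 2 ≤ ratioK α δ₀ * (15 / 128 * δ₀ ^ (-(11 / 8 : ℝ))) :=
    r3.trans (mul_le_mul_of_nonneg_left (mul_le_mul_of_nonneg_left hT3 (by norm_num)) hL0)
  have hp10 : 0 ≤ α * d ^ (α - 1) := mul_nonneg hα.le (Real.rpow_nonneg hd0.le _)
  have hp20 : 0 ≤ |α * (α - 1)| * d ^ (α - 2) / 2 := by
    have := Real.rpow_nonneg hd0.le (α - 2); positivity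
  -- assemble
  rw [stepModelK]
  have t1 : |α * d ^ (α - 1) * (c₂ * x + c₃ * x ^ 2 / 2 + u * (c₂ ^ 2 / (2 * d) - 4 / 3 * c₃))| ≤
      ratioK α δ₀ * (5 / 8 * δ₀ ^ (-(3 / 8 : ℝ))) *
        ((1 / ρ₀ + 1 / ρ₀ ^ 2) * |x| + (1 / (2 * δ₀ * ρ₀ ^ 2) + 3 / ρ₀ ^ 2) * u) := by
    rw [abs_mul, abs_of_nonneg hp10]
    exact mul_le_mul hp1 hLb (abs_nonneg _) (by positivity)
  have t2 : |1 / 2 * (α * (α - 1) * d ^ (α - 2)) * c₂ ^ 2 * x ^ 2| ≤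
      ratioK α δ₀ * (15 / 128 * δ₀ ^ (-(11 / 8 : ℝ))) * (1 / ρ₀ ^ 2 * |x|) := by
    have heq : 1 / 2 * (α * (α - 1) * d ^ (α - 2)) * c₂ ^ 2 * x ^ 2 =
        (α * (α - 1) * d ^ (α - 2) / 2) * (c₂ ^ 2 * x ^ 2) := by ring
    rw [heq, abs_mul]
    have habs : |α * (α - 1) * d ^ (α - 2) / 2| = |α * (α - 1)| * d ^ (α - 2) / 2 := by
      rw [abs_div, abs_mul, abs_of_nonneg (Real.rpow_nonneg hd0.le _), abs_two]
    rw [habs]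
    exact mul_le_mul hp2 hQb (abs_nonneg _) (by positivity)
  have t3 := abs_add_le (α * d ^ (α - 1) * (c₂ * x + c₃ * x ^ 2 / 2 + u * (c₂ ^ 2 / (2 * d) - 4 / 3 * c₃)))
    (1 / 2 * (α * (α - 1) * d ^ (α - 2)) * c₂ ^ 2 * x ^ 2)
  have hfin : ratioK α δ₀ * (5 / 8 * δ₀ ^ (-(3 / 8 : ℝ))) *
        ((1 / ρ₀ + 1 / ρ₀ ^ 2) * |x| + (1 / (2 * δ₀ * ρ₀ ^ 2) + 3 / ρ₀ ^ 2) * u) +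
      ratioK α δ₀ * (15 / 128 * δ₀ ^ (-(11 / 8 : ℝ))) * (1 / ρ₀ ^ 2 * |x|) ≤
      modelKP α δ₀ ρ₀ * (|x| + u) := by
    rw [modelKP]
    have w1 : 0 ≤ ratioK α δ₀ * (5 / 8 * δ₀ ^ (-(3 / 8 : ℝ))) := by
      have := Real.rpow_nonneg hδ0.le (-(3 / 8 : ℝ)); positivity
    have w2 : 0 ≤ ratioK α δ₀ * (15 / 128 * δ₀ ^ (-(11 / 8 : ℝ))) := by
      have := Real.rpow_nonneg hδ0.le (-(11 / 8 : ℝ)); positivity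
    have w3 : 0 ≤ 1 / ρ₀ + 1 / ρ₀ ^ 2 := by positivity
    have w4 : 0 ≤ 1 / (2 * δ₀ * ρ₀ ^ 2) + 3 / ρ₀ ^ 2 := by positivity
    have w5 : 0 ≤ 1 / ρ₀ ^ 2 := by positivity
    nlinarith [mul_nonneg w1 (mul_nonneg w3 hu0), mul_nonneg w1 (mul_nonneg w4 ha0),
      mul_nonneg w2 (mul_nonneg w5 hu0), mul_nonneg w1 w3, mul_nonneg w1 w4, mul_nonneg w2 w5]
  linarith

/-- The `|x|`-coefficient of the global bound of `stepModelK`. [folklore] -/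
def modelKA1 (α δ₀ ρ₀ : ℝ) : ℝ := ratioK α δ₀ * (5 / 8 * δ₀ ^ (-(3 / 8 : ℝ))) * (1 / ρ₀)

/-- The `x² + (8/3) u`-coefficient of the global bound of `stepModelK`. [folklore] -/
def modelKA2 (α δ₀ ρ₀ : ℝ) : ℝ :=
  ratioK α δ₀ * (5 / 8 * δ₀ ^ (-(3 / 8 : ℝ))) * (1 / ρ₀ ^ 2 + 3 / 8 * (1 / (2 * δ₀ * ρ₀ ^ 2) + 3 / ρ₀ ^ 2)) +
    ratioK α δ₀ * (15 / 128 * δ₀ ^ (-(11 / 8 : ℝ))) * (1 / ρ₀ ^ 2)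

/-- `0 ≤ modelKA1`, `0 ≤ modelKA2`. [folklore] -/
theorem modelKA_nonneg {α δ₀ ρ₀ : ℝ} (hα : 0 ≤ α) (hδ0 : 0 < δ₀) (hρ₀ : 0 < ρ₀) :
    0 ≤ modelKA1 α δ₀ ρ₀ ∧ 0 ≤ modelKA2 α δ₀ ρ₀ := by
  unfold modelKA1 modelKA2
  have := ratioK_nonneg hα hδ0
  have h1 : 0 ≤ δ₀ ^ (-(3 / 8 : ℝ)) := Real.rpow_nonneg hδ0.le _
  have h2 : 0 ≤ δ₀ ^ (-(11 / 8 : ℝ)) := Real.rpow_nonneg hδ0.le _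
  constructor <;> positivity

/-- **`|stepModelK α d c₂ c₃ u x| ≤ modelKA1 · |x| + modelKA2 · (x² + (8/3) u)` for EVERY real `x`**
(`0 < α`, `δ₀ ≤ d ≤ 1`, `|c₂| ≤ 1/ρ₀`, `|c₃| ≤ 2/ρ₀²`; as `abs_stepModel_le` of
`SLERestrictionOneStep` for `α = 5/8`, the prefactors compared by `ratioK_spec`). [folklore] -/
theorem abs_stepModelK_le_all {α d c₂ c₃ δ₀ ρ₀ : ℝ} {u : ℝ≥0} (hα : 0 < α) (hδ0 : 0 < δ₀) (hρ₀ : 0 < ρ₀)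
    (hδ : δ₀ ≤ d) (hd1 : d ≤ 1) (hc2 : |c₂| ≤ 1 / ρ₀) (hc3 : |c₃| ≤ 2 / ρ₀ ^ 2) (x : ℝ) :
    |stepModelK α d c₂ c₃ u x| ≤ modelKA1 α δ₀ ρ₀ * |x| + modelKA2 α δ₀ ρ₀ * (x ^ 2 + 8 / 3 * u) := by
  have hd0 : 0 < d := hδ0.trans_le hδ
  have hu0 : (0 : ℝ) ≤ u := u.coe_nonneg
  have ha0 : 0 ≤ |x| := abs_nonneg _
  obtain ⟨-, r2, r3⟩ := ratioK_spec hα hδ0 hδ hd1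
  have hL0 : 0 ≤ ratioK α δ₀ := ratioK_nonneg hα.le hδ0
  -- prefactor bounds at `d ≥ δ₀`
  have hT2 : d ^ (-(3 / 8 : ℝ)) ≤ δ₀ ^ (-(3 / 8 : ℝ)) := Real.rpow_le_rpow_of_nonpos hδ0 hδ (by norm_num)
  have hT3 : d ^ (-(11 / 8 : ℝ)) ≤ δ₀ ^ (-(11 / 8 : ℝ)) := Real.rpow_le_rpow_of_nonpos hδ0 hδ (by norm_num)
  set P := ratioK α δ₀ * (5 / 8 * δ₀ ^ (-(3 / 8 : ℝ))) with hP
  set Q := ratioK α δ₀ * (15 / 128 * δ₀ ^ (-(11 / 8 : ℝ))) with hQ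
  have hp1 : α * d ^ (α - 1) ≤ P := r2.trans (mul_le_mul_of_nonneg_left (mul_le_mul_of_nonneg_left hT2 (by norm_num)) hL0)
  have hp2 : |α * (α - 1)| * d ^ (α - 2) / 2 ≤ Q := r3.trans (mul_le_mul_of_nonneg_left (mul_le_mul_of_nonneg_left hT3 (by norm_num)) hL0)
  have hp10 : 0 ≤ α * d ^ (α - 1) := mul_nonneg hα.le (Real.rpow_nonneg hd0.le _)
  have hP0 : 0 ≤ P := hp10.trans hp1
  have hQ0 : 0 ≤ Q := by have := Real.rpow_nonneg hd0.le (α - 2); exact le_trans (by positivity) hp2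
  -- the bracket
  have hLb : |c₂ * x + c₃ * x ^ 2 / 2 + u * (c₂ ^ 2 / (2 * d) - 4 / 3 * c₃)| ≤
      1 / ρ₀ * |x| + 1 / ρ₀ ^ 2 * x ^ 2 + (1 / (2 * δ₀ * ρ₀ ^ 2) + 3 / ρ₀ ^ 2) * u := by
    have e1 : |c₂ * x| ≤ 1 / ρ₀ * |x| := by rw [abs_mul]; exact mul_le_mul_of_nonneg_right hc2 ha0
    have e2 : |c₃ * x ^ 2 / 2| ≤ 1 / ρ₀ ^ 2 * x ^ 2 := by
      rw [abs_div, abs_mul, abs_pow, sq_abs, abs_two]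
      have := mul_le_mul_of_nonneg_right hc3 (sq_nonneg x)
      have h' : 2 / ρ₀ ^ 2 * x ^ 2 / 2 = 1 / ρ₀ ^ 2 * x ^ 2 := by ring
      rw [← h']
      exact div_le_div_of_nonneg_right this (by norm_num)
    have e3 : |(u : ℝ) * (c₂ ^ 2 / (2 * d) - 4 / 3 * c₃)| ≤ (1 / (2 * δ₀ * ρ₀ ^ 2) + 3 / ρ₀ ^ 2) * u := by
      rw [abs_mul, abs_of_nonneg hu0, mul_comm]
      refine mul_le_mul_of_nonneg_right ((abs_sub _ _).trans (add_le_add ?_ ?_)) hu0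
      · rw [abs_div, abs_of_nonneg (sq_nonneg _), abs_of_pos (by positivity : (0 : ℝ) < 2 * d),
          div_le_div_iff₀ (by positivity) (by positivity)]
        have g1 : c₂ ^ 2 ≤ (1 / ρ₀) ^ 2 := by rw [← sq_abs]; exact pow_le_pow_left₀ (abs_nonneg _) hc2 2
        have g2 : c₂ ^ 2 * ρ₀ ^ 2 ≤ 1 := by
          have := mul_le_mul_of_nonneg_right g1 (sq_nonneg ρ₀)
          rwa [show (1 / ρ₀) ^ 2 * ρ₀ ^ 2 = 1 by field_simp] at this
        calc c₂ ^ 2 * (2 * δ₀ * ρ₀ ^ 2) = (c₂ ^ 2 * ρ₀ ^ 2) * (2 * δ₀) := by ring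
          _ ≤ 1 * (2 * δ₀) := mul_le_mul_of_nonneg_right g2 (by positivity)
          _ ≤ 1 * (2 * d) := by nlinarith
      · rw [abs_mul, show |(4 : ℝ) / 3| = 4 / 3 by norm_num]
        have g1 := mul_le_mul_of_nonneg_left hc3 (by norm_num : (0 : ℝ) ≤ 4 / 3)
        have g2 : 4 / 3 * (2 / ρ₀ ^ 2) ≤ 3 / ρ₀ ^ 2 := by
          rw [← mul_div_assoc, div_le_div_iff_of_pos_right (by positivity)]; norm_num
        exact g1.trans g2
    have e4 := abs_add_three (c₂ * x) (c₃ * x ^ 2 / 2) ((u : ℝ) * (c₂ ^ 2 / (2 * d) - 4 / 3 * c₃))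
    linarith
  have hL0' : 0 ≤ 1 / ρ₀ * |x| + 1 / ρ₀ ^ 2 * x ^ 2 + (1 / (2 * δ₀ * ρ₀ ^ 2) + 3 / ρ₀ ^ 2) * u := by positivity
  have hQb : |c₂ ^ 2 * x ^ 2| ≤ 1 / ρ₀ ^ 2 * x ^ 2 := by
    rw [abs_mul, abs_of_nonneg (sq_nonneg c₂), abs_pow, sq_abs]
    have g1 : c₂ ^ 2 ≤ (1 / ρ₀) ^ 2 := by rw [← sq_abs]; exact pow_le_pow_left₀ (abs_nonneg _) hc2 2
    calc c₂ ^ 2 * x ^ 2 ≤ (1 / ρ₀) ^ 2 * x ^ 2 := mul_le_mul_of_nonneg_right g1 (sq_nonneg _)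
      _ = 1 / ρ₀ ^ 2 * x ^ 2 := by ring
  rw [stepModelK]
  have t1 : |α * d ^ (α - 1) * (c₂ * x + c₃ * x ^ 2 / 2 + u * (c₂ ^ 2 / (2 * d) - 4 / 3 * c₃))| ≤
      P * (1 / ρ₀ * |x| + 1 / ρ₀ ^ 2 * x ^ 2 + (1 / (2 * δ₀ * ρ₀ ^ 2) + 3 / ρ₀ ^ 2) * u) := by
    rw [abs_mul, abs_of_nonneg hp10]
    exact mul_le_mul hp1 hLb (abs_nonneg _) hP0
  have t2 : |1 / 2 * (α * (α - 1) * d ^ (α - 2)) * c₂ ^ 2 * x ^ 2| ≤ Q * (1 / ρ₀ ^ 2 * x ^ 2) := by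
    have heq : 1 / 2 * (α * (α - 1) * d ^ (α - 2)) * c₂ ^ 2 * x ^ 2 =
        (α * (α - 1) * d ^ (α - 2) / 2) * (c₂ ^ 2 * x ^ 2) := by ring
    rw [heq, abs_mul]
    have habs : |α * (α - 1) * d ^ (α - 2) / 2| = |α * (α - 1)| * d ^ (α - 2) / 2 := by
      rw [abs_div, abs_mul, abs_of_nonneg (Real.rpow_nonneg hd0.le _), abs_two]
    rw [habs]
    exact mul_le_mul hp2 hQb (abs_nonneg _) hQ0
  have t3 := abs_add_le (α * d ^ (α - 1) * (c₂ * x + c₃ * x ^ 2 / 2 + u * (c₂ ^ 2 / (2 * d) - 4 / 3 * c₃)))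
    (1 / 2 * (α * (α - 1) * d ^ (α - 2)) * c₂ ^ 2 * x ^ 2)
  have hfin : P * (1 / ρ₀ * |x| + 1 / ρ₀ ^ 2 * x ^ 2 + (1 / (2 * δ₀ * ρ₀ ^ 2) + 3 / ρ₀ ^ 2) * u) +
      Q * (1 / ρ₀ ^ 2 * x ^ 2) ≤ modelKA1 α δ₀ ρ₀ * |x| + modelKA2 α δ₀ ρ₀ * (x ^ 2 + 8 / 3 * u) := by
    have e1 : modelKA1 α δ₀ ρ₀ = P * (1 / ρ₀) := by rw [modelKA1, hP]
    have e2 : modelKA2 α δ₀ ρ₀ = P * (1 / ρ₀ ^ 2 + 3 / 8 * (1 / (2 * δ₀ * ρ₀ ^ 2) + 3 / ρ₀ ^ 2)) + Q * (1 / ρ₀ ^ 2) := by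
      rw [modelKA2, hP, hQ]
    rw [e1, e2]
    have w1 : 0 ≤ P * (3 / 8 * (1 / (2 * δ₀ * ρ₀ ^ 2) + 3 / ρ₀ ^ 2)) * x ^ 2 := by positivity
    have w2 : 0 ≤ Q * (1 / ρ₀ ^ 2) * (8 / 3 * u) := by positivity
    have w3 : 0 ≤ P * (1 / ρ₀ ^ 2) * (8 / 3 * u) := by positivity
    nlinarith [w1, w2, w3]
  linarith

/-! ### The compensated expansion for one step of the flow -/

/-- The a priori bound `M_m` of the Schwarzian mass on the controlled class
(`abs_schwarzMass_le`). [folklore] -/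
def massBound (δ₀ ρ₀ : ℝ) : ℝ := 1 / (4 * δ₀ ^ 2 * ρ₀ ^ 2) + 1 / (3 * δ₀ * ρ₀ ^ 2)

/-- **The constant of the compensated one-step bound.** [folklore] -/
def compK (α lam δ₀ ρ₀ : ℝ) : ℝ :=
  ratioK α δ₀ * stepKcleanOf δ₀ (stepK δ₀ ρ₀) + modelKP α δ₀ ρ₀ * (lam * massBound δ₀ ρ₀) +
    (lam * massBound δ₀ ρ₀) ^ 2 + lam * massStepC δ₀ ρ₀

variable {B : Set ℂ} {ρ₀ : ℝ} {U : ℝ≥0 → ℝ} {u : ℝ≥0} {S : ℝ}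
variable (hB : IsStarHull B) (hU : Continuous U) (hU0 : U 0 = 0) (hu : 0 < u)
  (hS : ∀ v : ℝ≥0, v ≤ u → |U v| ≤ S) (hρ₀ : 0 < ρ₀) (hBρ : Disjoint (ball (0 : ℂ) (8 * ρ₀)) B)
  (hη : stepSize S u ≤ starDeriv B * ρ₀ / 1000)

include hB hU hU0 hu hS hρ₀ hBρ hη in
/-- **The compensated one-step expansion** ([LSW] Prop. 5.3 in conditional-increment form): on
the controlled class (`δ₀ ≤ d = Φ′_B(0)`, `ρ₀ ≤ 1`, `u, η ≤ 1`), for `α > 0`, `λ ≥ 0` with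
`λ u M_m ≤ 1`, and every real `J` (the integral of the mass over the step) with
`0 ≤ J ≤ u M_m` and `|J − u m(B)| ≤ u · massStepC δ₀ ρ₀ (u + η)`,

  `|d′^α e^{−λJ} − d^α − (stepModelK α d c₂ c₃ u x − λ u m(B) d^α)| ≤ compK α λ δ₀ ρ₀ · (u η + u² + |x|³ + u |x|)`,

`m(B) = bubbleMass d (c₂/2) (c₃/6) = c₂²/(4d²) − c₃/(6d) = −SE_B(0)/6`, `x = U_u`.
[cite: LawlerSchrammWerner2003Restriction, Prop. 5.3 with (5.2)–(5.3)] -/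
theorem abs_compensatedStep_le {α lam δ₀ J : ℝ} (hα : 0 < α) (hlam : 0 ≤ lam) (hρ1 : ρ₀ ≤ 1) (hδ0 : 0 < δ₀)
    (hδ : δ₀ ≤ starDeriv B) (hη1 : stepSize S u ≤ 1) (hu1 : (u : ℝ) ≤ 1)
    (hlam1 : lam * (u * massBound δ₀ ρ₀) ≤ 1) (hJ0 : 0 ≤ J) (hJM : J ≤ u * massBound δ₀ ρ₀)
    (hJ : |J - u * bubbleMass (starDeriv B) (starJet2 B / 2) (starJet3 B / 6)| ≤
      u * (massStepC δ₀ ρ₀ * (u + stepSize S u))) :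
    |starDeriv (slidHull U B u) ^ α * Real.exp (-(lam * J)) - starDeriv B ^ α -
        (stepModelK α (starDeriv B) (starJet2 B) (starJet3 B) u (U u) -
          lam * u * bubbleMass (starDeriv B) (starJet2 B / 2) (starJet3 B / 6) * starDeriv B ^ α)| ≤
      compK α lam δ₀ ρ₀ * (u * stepSize S u + u ^ 2 + |U u| ^ 3 + u * |U u|) := by
  obtain ⟨hUu, -, hη0⟩ := abs_driver_le hB hu hS hρ₀ hη
  obtain ⟨hd0, hd1, -⟩ := starDeriv_spec hB
  obtain ⟨-, -, hc2, hc3, -⟩ := starJet_spec hB hρ₀ hBρ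
  have hu0 : (0 : ℝ) ≤ u := u.coe_nonneg
  have ha0 : 0 ≤ |U u| := abs_nonneg _
  have hx1 : |U u| ≤ 1 := hUu.trans hη1
  -- the pieces
  have hE := abs_rpowK_sub_stepModelK_le_clean hB hU hU0 hu hS hρ₀ hBρ hη hα hρ1 hδ0 hδ hη1 hu1
  have hP := abs_stepModelK_le (u := u) hα hδ0 hρ₀ hδ hd1 hc2 hc3 hx1
  have hY0 : 0 ≤ starDeriv B ^ α := Real.rpow_nonneg hd0.le _
  have hY1 : starDeriv B ^ α ≤ 1 := Real.rpow_le_one hd0.le hd1 hα.le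
  have key := abs_compensated_sub_le (m := bubbleMass (starDeriv B) (starJet2 B / 2) (starJet3 B / 6))
    hY0 hY1 hlam hJ0 hE hP hJM hlam1 hJ
  -- the right-hand side is at most `compK · r`
  set r := (u : ℝ) * stepSize S u + u ^ 2 + |U u| ^ 3 + u * |U u| with hr
  have n1 : 0 ≤ (u : ℝ) * stepSize S u := mul_nonneg hu0 hη0.le
  have hr0 : 0 ≤ r := by positivity
  have h3 : 0 ≤ |U u| ^ 3 := pow_nonneg ha0 3
  have hsq : 0 ≤ (u : ℝ) ^ 2 := sq_nonneg _
  have hua0 : 0 ≤ (u : ℝ) * |U u| := mul_nonneg hu0 ha0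
  have hua : (u : ℝ) * |U u| ≤ r := by rw [hr]; linarith
  have hu2 : (u : ℝ) ^ 2 ≤ r := by rw [hr]; linarith
  have huη : (u : ℝ) * (u + stepSize S u) ≤ r := by
    have : (u : ℝ) * (u + stepSize S u) = u * stepSize S u + u ^ 2 := by ring
    rw [this, hr]; linarith
  have hKP0 : 0 ≤ modelKP α δ₀ ρ₀ := modelKP_nonneg hα.le hδ0 hρ₀
  have q2 : modelKP α δ₀ ρ₀ * (|U u| + u) * (lam * (u * massBound δ₀ ρ₀)) ≤
      modelKP α δ₀ ρ₀ * (lam * massBound δ₀ ρ₀) * r := by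
    have : modelKP α δ₀ ρ₀ * (|U u| + u) * (lam * (u * massBound δ₀ ρ₀)) =
        modelKP α δ₀ ρ₀ * (lam * massBound δ₀ ρ₀) * ((|U u| + u) * u) := by ring
    rw [this]
    have h2 : (|U u| + u) * (u : ℝ) ≤ r := by
      have : (|U u| + u) * (u : ℝ) = u * |U u| + u ^ 2 := by ring
      rw [this, hr]; linarith
    have hMB : 0 ≤ massBound δ₀ ρ₀ := by
      rw [massBound]; positivity
    exact mul_le_mul_of_nonneg_left h2 (mul_nonneg hKP0 (mul_nonneg hlam hMB))
  have q3 : (lam * (u * massBound δ₀ ρ₀)) ^ 2 ≤ (lam * massBound δ₀ ρ₀) ^ 2 * r := by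
    have : (lam * (u * massBound δ₀ ρ₀)) ^ 2 = (lam * massBound δ₀ ρ₀) ^ 2 * u ^ 2 := by ring
    rw [this]
    exact mul_le_mul_of_nonneg_left hu2 (sq_nonneg _)
  have q4 : lam * (u * (massStepC δ₀ ρ₀ * (u + stepSize S u))) ≤ lam * massStepC δ₀ ρ₀ * r := by
    have : lam * (u * (massStepC δ₀ ρ₀ * (u + stepSize S u))) = lam * massStepC δ₀ ρ₀ * (u * (u + stepSize S u)) := by
      ring
    rw [this]
    exact mul_le_mul_of_nonneg_left huη (mul_nonneg hlam (massStepC_nonneg hδ0 hρ₀))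
  have hsum : ratioK α δ₀ * stepKcleanOf δ₀ (stepK δ₀ ρ₀) * r + modelKP α δ₀ ρ₀ * (lam * massBound δ₀ ρ₀) * r +
      (lam * massBound δ₀ ρ₀) ^ 2 * r + lam * massStepC δ₀ ρ₀ * r = compK α lam δ₀ ρ₀ * r := by
    rw [compK]; ring
  linarith [key, q2, q3, q4, hsum]

end Loewner

end Literature.Probability.RandomPlanarGeometry

end
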